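import Mathlib
import HarnessLib
import Summits.ValiantsHypothesis.ValiantsHypothesis.Theorems.LacunarySymmetroidMatrixDescartesProductPlusOneThetaShell
import Summits.ValiantsHypothesis.ValiantsHypothesis.Theorems.LacunarySymmetroidMatrixDescartesProductPlusOneOneBump
import Summits.ValiantsHypothesis.ValiantsHypothesis.Theorems.LacunarySymmetroidMatrixDescartesProductPlusOneSlopeLine

/-!
# LINE (A) `product_plus_one` (crux `MatrixDescartes`, stmt-ValiantsHypothesis-18050, V1) — W-CB, ★★ the RATE-FREE SLOW-KNEE CELL (E4⁺):
# `W(∏ f_j)` has AT MOST TWO roots in a window when every row is a slow-pair binomial, a binomial POLE of any pair, or an unswitched cloud row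

Owner memo `pub/ideators/val-idea-25/NOTE-idea25g3-18050-LINEA-AB-reduction.md` §19–§22 (val-idea-25 g4, W-CB: «count = 2·(1 + #fast knees)»; this is the
`K^> = 0` statement with POLES OF ALL RATES).  `K = 3`, support `d 0 < d 1 < d 2` — NO gap condition; window `(u,v)`, `0 < u`; every row `f_j = Σ_l C (a j l) X^{d l}`
is one of: (K) a binomial on the SLOW pair `(d0,d1)` of any signs whose root (if any) is not in `(u,v)` (`0 ≤ f_j(u)·f_j(v)`: slow knees, switched and
unswitched slow pullers); (P02) a binomial POLE on `(d0,d2)` (`a_{j0}a_{j2} < 0`, `0 ≤ f_j(u)f_j(v)` — e.g. the switched fast pullers `(+,0,−)` excluded from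
✓ `…SlowKneeCloudCell`); (P12) a binomial pole on `(d1,d2)` when `d1 − d0 ≤ d2 − d1`, (K12) a binomial knee on `(d1,d2)` when `d2 − d1 ≤ d1 − d0`; (C) an unswitched
incoherent trinomial (`a_{j0} > 0`, `a_{j1}, a_{j2} ≤ 0`, `a_{j1}+a_{j2} < 0`, `f_j(v) > 0`).  Then `W(∏_j f_j)` has at most two roots in `(u,v)`.

Proof: ✓ `logWronskian_prod_eq_rowPsi1_sum` (`W(P)(x) = −P(x)²·S(x)`, `S = Σ_j ψ₁^{(j)}`) and the θ-shell ✓ `no_three_zeros_of_theta_sq_law` with `n = e₁`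
(`p = d1 − d0 = e₁ + 1`): every menu row obeys the STRICT rate law `p²ψ₁ < ψ₃` on the window — (K) `ψ₃ − p²ψ₁ = 6ψ₁² > 0` (✓ `pair01_rowPsi3_law`),
(P02) `= 6ψ₁² + (q²−p²)ψ₁` with `ψ₁ > 0` (✓ `pair02_rowPsi3_law`), (P12)/(K12) `= 6ψ₁² + ((q−p)²−p²)ψ₁` with the sign of `ψ₁`
matching the rate comparison (✓ `pair12_rowPsi3_law`; signs of `ψ₁` by ✓ `pair01_pole_rowPsi1_pos` / `pair01_knee_rowPsi1_neg` / `pair02_pole_rowPsi1_pos` /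
`pair12_pole_rowPsi1_pos` / `pair12_knee_rowPsi1_neg` of val-lit-p7 g17's ✓ `…OneBump`), (C) ✓ `cloud_rowPsi3_gt`.

* `binomial_ne_zero_of_endpoints` — a binomial `c₀ + c₁x^n` with `0 ≤ g(u)g(v)` has no zero in `(u,v)`;
* `slowKneeCellRateFree_wronskian_no_three_zeros` (three-point form, `0 < m`), ★★ `slowKneeCellRateFree_wronskian_roots_le_two` (the count).

Strictly contains ✓ `slowKneeCloud_wronskian_roots_le_two` (E4).  Honest framing: ONE W-cell (helper); the fast-KNEE cell (#19), `WronskianBudgetK3`,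
`OneChangeFloorK3`, `stub_classRowK3`, `stub_polyLaw`, `MatrixDescartes`, B are NOT proved; `VP ≠ VNP` NOT proved.  No definitions, no named facts.
-/

set_option linter.dupNamespace false

namespace Summit.ValiantsHypothesis.ValiantsHypothesis.Theorems.LacunarySymmetroidMatrixDescartes

namespace ProductPlusOne

open Finset Set Polynomial
open scoped BigOperators Topology Polynomial

/-- A binomial `g(x) = c₀ + c₁x^n` (`n ≥ 1`) with `0 ≤ g(u)·g(v)`, `0 < u`, has no zero in `(u, v)`. [folklore] -/
theorem binomial_ne_zero_of_endpoints (c₀ c₁ : ℝ) {n : ℕ} (hn : n ≠ 0) {u v x : ℝ} (hu : 0 < u) (hx : x ∈ Ioo u v)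
    (hend : 0 ≤ (c₀ + c₁ * u ^ n) * (c₀ + c₁ * v ^ n)) (hc₁ : c₁ ≠ 0) : c₀ + c₁ * x ^ n ≠ 0 := by
  intro h0
  have hc0 : c₀ = -(c₁ * x ^ n) := by linarith
  have hux : u ^ n < x ^ n := pow_lt_pow_left₀ hx.1 hu.le hn
  have hxv : x ^ n < v ^ n := pow_lt_pow_left₀ hx.2 (hu.le.trans hx.1.le) hn
  rw [hc0] at hend
  have h1 : (-(c₁ * x ^ n) + c₁ * u ^ n) * (-(c₁ * x ^ n) + c₁ * v ^ n) = -(c₁ ^ 2 * ((x ^ n - u ^ n) * (v ^ n - x ^ n))) := by ring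
  rw [h1] at hend
  have h2 : 0 < c₁ ^ 2 * ((x ^ n - u ^ n) * (v ^ n - x ^ n)) :=
    mul_pos (by positivity) (mul_pos (by linarith) (by linarith))
  linarith

/-- ★★ **THE RATE-FREE SLOW-KNEE CELL, three-point form** (`0 < m`; see the module docstring for the row menu).  `W(∏_j f_j)` does not vanish at three
points `x₁ < x₂ < x₃` of `(u, v)`. [this file's theorem] -/
theorem slowKneeCellRateFree_wronskian_no_three_zeros {m : ℕ} (hm : 0 < m) (d : Fin 3 → ℕ) (h01 : d 0 < d 1) (h12 : d 1 < d 2)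
    (a : Fin m → Fin 3 → ℝ) {u v : ℝ} (hu : 0 < u)
    (hrow : ∀ j,
      (a j 2 = 0 ∧ a j 0 ≠ 0 ∧ a j 1 ≠ 0 ∧
          0 ≤ (∑ l, C (a j l) * X ^ (d l) : ℝ[X]).eval u * (∑ l, C (a j l) * X ^ (d l) : ℝ[X]).eval v) ∨
      (a j 1 = 0 ∧ a j 0 * a j 2 < 0 ∧
          0 ≤ (∑ l, C (a j l) * X ^ (d l) : ℝ[X]).eval u * (∑ l, C (a j l) * X ^ (d l) : ℝ[X]).eval v) ∨
      (a j 0 = 0 ∧ a j 1 * a j 2 < 0 ∧ d 1 - d 0 ≤ d 2 - d 1 ∧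
          0 ≤ (∑ l, C (a j l) * X ^ (d l) : ℝ[X]).eval u * (∑ l, C (a j l) * X ^ (d l) : ℝ[X]).eval v) ∨
      (a j 0 = 0 ∧ 0 < a j 1 * a j 2 ∧ d 2 - d 1 ≤ d 1 - d 0) ∨
      (0 < a j 0 ∧ a j 1 ≤ 0 ∧ a j 2 ≤ 0 ∧ a j 1 + a j 2 < 0 ∧ 0 < (∑ l, C (a j l) * X ^ (d l) : ℝ[X]).eval v))
    {x₁ x₂ x₃ : ℝ} (h₁ : x₁ ∈ Ioo u v) (h₃ : x₃ ∈ Ioo u v) (h12' : x₁ < x₂) (h23 : x₂ < x₃)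
    (hzero : ∀ x ∈ ({x₁, x₂, x₃} : Set ℝ),
      ((∏ j, ∑ l, C (a j l) * X ^ (d l) : ℝ[X]) * (X * derivative (X * derivative (∏ j, ∑ l, C (a j l) * X ^ (d l) : ℝ[X])))
        - (X * derivative (∏ j, ∑ l, C (a j l) * X ^ (d l) : ℝ[X])) ^ 2).eval x = 0) : False := by
  classical
  obtain ⟨e₁, he₁⟩ := Nat.exists_eq_add_of_lt h01
  obtain ⟨e₂, he₂⟩ := Nat.exists_eq_add_of_lt h12
  have hd := fin3_support_eq_gaps d e₁ e₂ he₁ he₂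
  have hev : ∀ j x, (∑ l, C (a j l) * X ^ (d l) : ℝ[X]).eval x
      = x ^ (d 0) * (a j 0 + a j 1 * x ^ (e₁ + 1) + a j 2 * x ^ (e₁ + e₂ + 2)) := by
    intro j x
    have h := (eval_trinomial_three (d 0) (e₁ + 1) (e₁ + e₂ + 2) (a j) x).1
    rw [hd] at h; rw [h]; ring
  have huv : u < v := h₁.1.trans h₁.2
  have hv : 0 < v := hu.trans huv
  have h₂ : x₂ ∈ Ioo u v := ⟨h₁.1.trans h12', h23.trans h₃.2⟩
  have hIoo : ∀ x ∈ ({x₁, x₂, x₃} : Set ℝ), x ∈ Ioo u v := by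
    intro x hx
    simp only [Set.mem_insert_iff, Set.mem_singleton_iff] at hx
    rcases hx with h | h | h <;> subst h <;> assumption
  -- the endpoint product of `f_j` controls the stripped row
  have hstrip : ∀ j, 0 ≤ (∑ l, C (a j l) * X ^ (d l) : ℝ[X]).eval u * (∑ l, C (a j l) * X ^ (d l) : ℝ[X]).eval v →
      0 ≤ (a j 0 + a j 1 * u ^ (e₁ + 1) + a j 2 * u ^ (e₁ + e₂ + 2)) * (a j 0 + a j 1 * v ^ (e₁ + 1) + a j 2 * v ^ (e₁ + e₂ + 2)) := by
    intro j h
    rw [hev, hev] at h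
    have hpow : 0 < u ^ (d 0) * v ^ (d 0) := mul_pos (pow_pos hu _) (pow_pos hv _)
    have : u ^ (d 0) * (a j 0 + a j 1 * u ^ (e₁ + 1) + a j 2 * u ^ (e₁ + e₂ + 2))
        * (v ^ (d 0) * (a j 0 + a j 1 * v ^ (e₁ + 1) + a j 2 * v ^ (e₁ + e₂ + 2)))
        = (u ^ (d 0) * v ^ (d 0)) * ((a j 0 + a j 1 * u ^ (e₁ + 1) + a j 2 * u ^ (e₁ + e₂ + 2))
          * (a j 0 + a j 1 * v ^ (e₁ + 1) + a j 2 * v ^ (e₁ + e₂ + 2))) := by ring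
    rw [this] at h
    exact (mul_nonneg_iff_of_pos_left hpow).1 h
  -- KEY FACTS per row on the window: the normal form does not vanish, and the STRICT rate law `p²ψ₁ < ψ₃`
  have hkey : ∀ j, ∀ x ∈ Ioo u v,
      a j 0 - (-(a j 1)) * x ^ (e₁ + 1) - (-(a j 2)) * x ^ (e₁ + e₂ + 2) ≠ 0 ∧
      ((e₁ : ℝ) + 1) ^ 2 * rowPsi1 e₁ e₂ (a j 0) (-(a j 1)) (-(a j 2)) x
        < rowPsi3 e₁ e₂ (a j 0) (-(a j 1)) (-(a j 2)) x := by
    intro j x hx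
    have hx0 : 0 < x := hu.trans hx.1
    rcases hrow j with ⟨h2, h0, h1, hend⟩ | ⟨h1, h02, hend⟩ | ⟨h0, h12s, hrate, hend⟩ | ⟨h0, h12s, hrate⟩ | hc
    · -- (K) slow-pair binomial
      have hn2 : -(a j 2) = 0 := by rw [h2, neg_zero]
      have hg := hstrip j hend
      rw [h2] at hg
      simp only [zero_mul, add_zero] at hg
      have hne : a j 0 + a j 1 * x ^ (e₁ + 1) ≠ 0 :=
        binomial_ne_zero_of_endpoints (a j 0) (a j 1) (Nat.succ_ne_zero e₁) hu hx hg h1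
      have hF : a j 0 - (-(a j 1)) * x ^ (e₁ + 1) ≠ 0 := by
        have : a j 0 - (-(a j 1)) * x ^ (e₁ + 1) = a j 0 + a j 1 * x ^ (e₁ + 1) := by ring
        rwa [this]
      rw [hn2]
      refine ⟨by rwa [zero_mul, sub_zero], ?_⟩
      have hlaw := pair01_rowPsi3_law e₁ e₂ (a j 0) (-(a j 1)) x
      have hψ : rowPsi1 e₁ e₂ (a j 0) (-(a j 1)) 0 x ≠ 0 := by
        rcases lt_or_gt_of_ne (mul_ne_zero h0 (neg_ne_zero.2 h1)) with hneg | hposAB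
        · exact (pair01_knee_rowPsi1_neg e₁ e₂ (a j 0) (-(a j 1)) hx0 hneg).ne
        · exact (pair01_pole_rowPsi1_pos e₁ e₂ (a j 0) (-(a j 1)) hx0 hposAB hF).ne'
      have hsq : 0 < rowPsi1 e₁ e₂ (a j 0) (-(a j 1)) 0 x ^ 2 := by positivity
      linarith
    · -- (P02) pole on the pair (d0,d2)
      have hn1 : -(a j 1) = 0 := by rw [h1, neg_zero]
      have hg := hstrip j hend
      rw [h1] at hg
      simp only [zero_mul, add_zero] at hg
      have ha2 : a j 2 ≠ 0 := by rintro h; rw [h, mul_zero] at h02; exact lt_irrefl _ h02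
      have hne : a j 0 + a j 2 * x ^ (e₁ + e₂ + 2) ≠ 0 :=
        binomial_ne_zero_of_endpoints (a j 0) (a j 2) (Nat.succ_ne_zero _) hu hx hg ha2
      have hF : a j 0 - (-(a j 2)) * x ^ (e₁ + e₂ + 2) ≠ 0 := by
        have : a j 0 - (-(a j 2)) * x ^ (e₁ + e₂ + 2) = a j 0 + a j 2 * x ^ (e₁ + e₂ + 2) := by ring
        rwa [this]
      rw [hn1]
      refine ⟨by rwa [zero_mul, sub_zero], ?_⟩
      have hlaw := pair02_rowPsi3_law e₁ e₂ (a j 0) (-(a j 2)) x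
      have hψpos : 0 < rowPsi1 e₁ e₂ (a j 0) 0 (-(a j 2)) x :=
        pair02_pole_rowPsi1_pos e₁ e₂ (a j 0) (-(a j 2)) hx0 (by nlinarith) hF
      have hpq : ((e₁ : ℝ) + 1) ^ 2 ≤ ((e₁ : ℝ) + e₂ + 2) ^ 2 := by nlinarith [(e₁.cast_nonneg : (0:ℝ) ≤ e₁), (e₂.cast_nonneg : (0:ℝ) ≤ e₂)]
      nlinarith
    · -- (P12) pole on the pair (d1,d2), rate `e₂ + 1 ≥ e₁ + 1`
      have hg := hstrip j hend
      rw [h0] at hg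
      simp only [zero_add] at hg
      have ha2 : a j 2 ≠ 0 := by rintro h; rw [h, mul_zero] at h12s; exact lt_irrefl _ h12s
      have hg' : 0 ≤ (a j 1 + a j 2 * u ^ (e₂ + 1)) * (a j 1 + a j 2 * v ^ (e₂ + 1)) := by
        have hfac : (a j 1 * u ^ (e₁ + 1) + a j 2 * u ^ (e₁ + e₂ + 2)) * (a j 1 * v ^ (e₁ + 1) + a j 2 * v ^ (e₁ + e₂ + 2))
            = (u ^ (e₁ + 1) * v ^ (e₁ + 1)) * ((a j 1 + a j 2 * u ^ (e₂ + 1)) * (a j 1 + a j 2 * v ^ (e₂ + 1))) := by ring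
        rw [hfac] at hg
        exact (mul_nonneg_iff_of_pos_left (mul_pos (pow_pos hu _) (pow_pos hv _))).1 hg
      have hne : a j 1 + a j 2 * x ^ (e₂ + 1) ≠ 0 :=
        binomial_ne_zero_of_endpoints (a j 1) (a j 2) (Nat.succ_ne_zero _) hu hx hg' ha2
      have hF : (0 : ℝ) - (-(a j 1)) * x ^ (e₁ + 1) - (-(a j 2)) * x ^ (e₁ + e₂ + 2) ≠ 0 := by
        have : (0 : ℝ) - (-(a j 1)) * x ^ (e₁ + 1) - (-(a j 2)) * x ^ (e₁ + e₂ + 2)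
            = x ^ (e₁ + 1) * (a j 1 + a j 2 * x ^ (e₂ + 1)) := by ring
        rw [this]; exact mul_ne_zero (pow_ne_zero _ hx0.ne') hne
      rw [h0]
      refine ⟨hF, ?_⟩
      have hlaw := pair12_rowPsi3_law e₁ e₂ (-(a j 1)) (-(a j 2)) hF
      have hψpos : 0 < rowPsi1 e₁ e₂ 0 (-(a j 1)) (-(a j 2)) x :=
        pair12_pole_rowPsi1_pos e₁ e₂ (-(a j 1)) (-(a j 2)) hx0 (by nlinarith) hF
      have hrate' : e₁ ≤ e₂ := by omega
      have hpq : ((e₁ : ℝ) + 1) ^ 2 ≤ ((e₂ : ℝ) + 1) ^ 2 := by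
        have : (e₁ : ℝ) ≤ e₂ := by exact_mod_cast hrate'
        nlinarith [(e₁.cast_nonneg : (0:ℝ) ≤ e₁)]
      nlinarith
    · -- (K12) knee on the pair (d1,d2), rate `e₂ + 1 ≤ e₁ + 1`
      have hsame : ∀ y : ℝ, 0 < y → a j 1 + a j 2 * y ^ (e₂ + 1) ≠ 0 := by
        intro y hy h
        have : a j 1 * (a j 1 + a j 2 * y ^ (e₂ + 1)) = 0 := by rw [h, mul_zero]
        have h' : a j 1 * a j 1 + a j 1 * a j 2 * y ^ (e₂ + 1) = 0 := by linarith [this]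
        nlinarith [mul_self_nonneg (a j 1), mul_pos h12s (pow_pos hy (e₂ + 1))]
      have hF : (0 : ℝ) - (-(a j 1)) * x ^ (e₁ + 1) - (-(a j 2)) * x ^ (e₁ + e₂ + 2) ≠ 0 := by
        have : (0 : ℝ) - (-(a j 1)) * x ^ (e₁ + 1) - (-(a j 2)) * x ^ (e₁ + e₂ + 2)
            = x ^ (e₁ + 1) * (a j 1 + a j 2 * x ^ (e₂ + 1)) := by ring
        rw [this]; exact mul_ne_zero (pow_ne_zero _ hx0.ne') (hsame x hx0)
      rw [h0]
      refine ⟨hF, ?_⟩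
      have hlaw := pair12_rowPsi3_law e₁ e₂ (-(a j 1)) (-(a j 2)) hF
      have hψneg : rowPsi1 e₁ e₂ 0 (-(a j 1)) (-(a j 2)) x < 0 :=
        pair12_knee_rowPsi1_neg e₁ e₂ (-(a j 1)) (-(a j 2)) hx0 (by nlinarith)
      have hrate' : e₂ ≤ e₁ := by omega
      have hpq : ((e₂ : ℝ) + 1) ^ 2 ≤ ((e₁ : ℝ) + 1) ^ 2 := by
        have : (e₂ : ℝ) ≤ e₁ := by exact_mod_cast hrate'
        nlinarith [(e₂.cast_nonneg : (0:ℝ) ≤ e₂)]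
      have hψne : rowPsi1 e₁ e₂ 0 (-(a j 1)) (-(a j 2)) x ≠ 0 := hψneg.ne
      have hsq : 0 < rowPsi1 e₁ e₂ 0 (-(a j 1)) (-(a j 2)) x ^ 2 := by positivity
      nlinarith
    · -- (C) unswitched incoherent cloud row
      obtain ⟨_, h1, h2, h12s, hvpos⟩ := hc
      have hpos : 0 < a j 0 - (-(a j 1)) * x ^ (e₁ + 1) - (-(a j 2)) * x ^ (e₁ + e₂ + 2) := by
        rw [hev] at hvpos
        have h3 : 0 < a j 0 + a j 1 * v ^ (e₁ + 1) + a j 2 * v ^ (e₁ + e₂ + 2) := (mul_pos_iff_of_pos_left (pow_pos hv _)).1 hvpos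
        have hm1 : a j 1 * v ^ (e₁ + 1) ≤ a j 1 * x ^ (e₁ + 1) :=
          mul_le_mul_of_nonpos_left (pow_le_pow_left₀ hx0.le hx.2.le _) h1
        have hm2 : a j 2 * v ^ (e₁ + e₂ + 2) ≤ a j 2 * x ^ (e₁ + e₂ + 2) :=
          mul_le_mul_of_nonpos_left (pow_le_pow_left₀ hx0.le hx.2.le _) h2
        linarith
      exact ⟨hpos.ne', cloud_rowPsi3_gt e₁ e₂ (a j 0) (-(a j 1)) (-(a j 2)) hx0 (by linarith) (by linarith) (by linarith) hpos⟩
  -- no row vanishes on the window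
  have hf : ∀ x ∈ Ioo u v, ∀ j, (∑ l, C (a j l) * X ^ (d l) : ℝ[X]).eval x ≠ 0 := by
    intro x hx j
    have hx0 : 0 < x := hu.trans hx.1
    rw [hev]
    have : a j 0 + a j 1 * x ^ (e₁ + 1) + a j 2 * x ^ (e₁ + e₂ + 2)
        = a j 0 - (-(a j 1)) * x ^ (e₁ + 1) - (-(a j 2)) * x ^ (e₁ + e₂ + 2) := by ring
    rw [this]
    exact mul_ne_zero (pow_ne_zero _ hx0.ne') (hkey j x hx).1
  -- at a root of `W(P)` in the window the slopes sum to zero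
  have hsum : ∀ x ∈ ({x₁, x₂, x₃} : Set ℝ), ∑ j, rowPsi1 e₁ e₂ (a j 0) (-(a j 1)) (-(a j 2)) x = 0 := by
    intro x hx
    have hxI := hIoo x hx
    have hx0 : 0 < x := hu.trans hxI.1
    have h := hzero x hx
    rw [logWronskian_prod_eq_rowPsi1_sum d e₁ e₂ he₁ he₂ a hx0 (hf x hxI)] at h
    have hP : ((∏ j, (∑ l, C (a j l) * X ^ (d l) : ℝ[X])).eval x) ≠ 0 := by
      rw [eval_prod]; exact Finset.prod_ne_zero_iff.2 fun j _ => hf x hxI j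
    rcases mul_eq_zero.1 h with h1 | h1
    · exact absurd (neg_eq_zero.1 h1) (pow_ne_zero 2 hP)
    · exact h1
  -- the θ-shell with `S = Σψ₁`, `S₁ = Σψ₂`, `S₂ = Σψ₃`
  refine no_three_zeros_of_theta_sq_law e₁ hu.le
    (S := fun x => ∑ j, rowPsi1 e₁ e₂ (a j 0) (-(a j 1)) (-(a j 2)) x)
    (S₁ := fun x => ∑ j, rowPsi2 e₁ e₂ (a j 0) (-(a j 1)) (-(a j 2)) x)
    (S₂ := fun x => ∑ j, rowPsi3 e₁ e₂ (a j 0) (-(a j 1)) (-(a j 2)) x)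
    ?_ ?_ ?_ h₁ h₃ h12' h23 (hsum x₁ (by simp)) (hsum x₂ (by simp)) (hsum x₃ (by simp))
  · intro x hx
    have hx0 : x ≠ 0 := (hu.trans hx.1).ne'
    have h := HasDerivAt.fun_sum (u := Finset.univ)
      (fun j _ => hasDerivAt_rowPsi1 e₁ e₂ (a j 0) (-(a j 1)) (-(a j 2)) hx0 (hkey j x hx).1)
    simpa only [Finset.sum_div] using h
  · intro x hx
    have hx0 : x ≠ 0 := (hu.trans hx.1).ne'
    have h := HasDerivAt.fun_sum (u := Finset.univ)
      (fun j _ => hasDerivAt_rowPsi2 e₁ e₂ (a j 0) (-(a j 1)) (-(a j 2)) hx0 (hkey j x hx).1)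
    simpa only [Finset.sum_div] using h
  · intro x hx
    rw [Finset.mul_sum]
    exact Finset.sum_lt_sum (fun j _ => (hkey j x hx).2.le) ⟨⟨0, hm⟩, Finset.mem_univ _, (hkey _ x hx).2⟩

/-- ★★ **THE RATE-FREE SLOW-KNEE CELL**: under the row menu of `slowKneeCellRateFree_wronskian_no_three_zeros` (any `m`), `W(∏_j f_j)` has AT MOST TWO
roots in `(u, v)`. [this file's theorem] -/
theorem slowKneeCellRateFree_wronskian_roots_le_two {m : ℕ} (d : Fin 3 → ℕ) (h01 : d 0 < d 1) (h12 : d 1 < d 2)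
    (a : Fin m → Fin 3 → ℝ) {u v : ℝ} (hu : 0 < u)
    (hrow : ∀ j,
      (a j 2 = 0 ∧ a j 0 ≠ 0 ∧ a j 1 ≠ 0 ∧
          0 ≤ (∑ l, C (a j l) * X ^ (d l) : ℝ[X]).eval u * (∑ l, C (a j l) * X ^ (d l) : ℝ[X]).eval v) ∨
      (a j 1 = 0 ∧ a j 0 * a j 2 < 0 ∧
          0 ≤ (∑ l, C (a j l) * X ^ (d l) : ℝ[X]).eval u * (∑ l, C (a j l) * X ^ (d l) : ℝ[X]).eval v) ∨
      (a j 0 = 0 ∧ a j 1 * a j 2 < 0 ∧ d 1 - d 0 ≤ d 2 - d 1 ∧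
          0 ≤ (∑ l, C (a j l) * X ^ (d l) : ℝ[X]).eval u * (∑ l, C (a j l) * X ^ (d l) : ℝ[X]).eval v) ∨
      (a j 0 = 0 ∧ 0 < a j 1 * a j 2 ∧ d 2 - d 1 ≤ d 1 - d 0) ∨
      (0 < a j 0 ∧ a j 1 ≤ 0 ∧ a j 2 ≤ 0 ∧ a j 1 + a j 2 < 0 ∧ 0 < (∑ l, C (a j l) * X ^ (d l) : ℝ[X]).eval v)) :
    (((∏ j, ∑ l, C (a j l) * X ^ (d l) : ℝ[X]) * (X * derivative (X * derivative (∏ j, ∑ l, C (a j l) * X ^ (d l) : ℝ[X])))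
        - (X * derivative (∏ j, ∑ l, C (a j l) * X ^ (d l) : ℝ[X])) ^ 2).roots.toFinset.filter (fun t => u < t ∧ t < v)).card ≤ 2 := by
  classical
  set W : ℝ[X] := (∏ j, ∑ l, C (a j l) * X ^ (d l) : ℝ[X]) * (X * derivative (X * derivative (∏ j, ∑ l, C (a j l) * X ^ (d l) : ℝ[X])))
      - (X * derivative (∏ j, ∑ l, C (a j l) * X ^ (d l) : ℝ[X])) ^ 2 with hWdef
  by_contra hgt
  push Not at hgt
  obtain ⟨y₁, hy₁, y₂, hy₂, y₃, hy₃, h12', h23⟩ := exists_three_lt_of_card (T := W.roots.toFinset.filter (fun t => u < t ∧ t < v)) hgt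
  by_cases hW0 : W = 0
  · rw [hW0, roots_zero, Multiset.toFinset_zero, Finset.filter_empty] at hy₁; exact absurd hy₁ (Finset.notMem_empty _)
  have hm : 0 < m := by
    rcases Nat.eq_zero_or_pos m with h0 | hpos
    · subst h0
      exact absurd (by rw [hWdef]; simp) hW0
    · exact hpos
  rw [mem_filter, Multiset.mem_toFinset, mem_roots hW0] at hy₁ hy₂ hy₃
  refine slowKneeCellRateFree_wronskian_no_three_zeros hm d h01 h12 a hu hrow (x₁ := y₁) (x₂ := y₂) (x₃ := y₃)
    hy₁.2 hy₃.2 h12' h23 ?_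
  intro x hx
  simp only [Set.mem_insert_iff, Set.mem_singleton_iff] at hx
  rcases hx with h | h | h <;> subst h
  · exact hy₁.1
  · exact hy₂.1
  · exact hy₃.1

end ProductPlusOne

end Summit.ValiantsHypothesis.ValiantsHypothesis.Theorems.LacunarySymmetroidMatrixDescartes
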